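import Mathlib.Combinatorics.HalesJewett
import Mathlib.Data.Fintype.Card
import Mathlib.Data.Fintype.EquivFin
import Mathlib.Logic.Function.Basic
import HarnessLib

/-!
# Combinatorial subspaces: composition, action on variable words, padding; Hales–Jewett in
every large dimension

Topic `Literature/Combinatorics/HalesJewett`. A toolkit on top of Mathlib's
`Mathlib/Combinatorics/HalesJewett.lean` (`Combinatorics.Line α ι`, `Combinatorics.Subspace η α ι`,
the Hales–Jewett theorem `Combinatorics.Line.exists_mono_in_high_dimension` and its
multidimensional form `Combinatorics.Subspace.exists_mono_in_high_dimension`), written for the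
formalisation of the density Hales–Jewett theorem along Dodos–Kanellopoulos–Tyros (the tree's
named fact `Literature.Combinatorics.HalesJewett.DensityHalesJewett`). Dictionary with
P. Dodos, V. Kanellopoulos, K. Tyros, *A simple proof of the density Hales–Jewett theorem*,
IMRN 2014, §2: a word of `[k]^n` is `x : ι → α`; a *variable word* (a word over `α ∪ {v}` using
the letter `v`) is Mathlib's `l : Line α ι` (`l.idxFun : ι → Option α`, `none` = the letter `v`)
and `{l a : a ∈ α}` is the combinatorial line it generates; an `m`-*variable word* is
`V : Subspace η α ι` (`η` = the set of the `m` variable letters) and `{V x : x : η → α}` is the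
`m`-dimensional combinatorial subspace it generates.

Provided here (all elementary; the declarations named `Combinatorics.Subspace.…` are deliberate
dot-notation extensions of Mathlib's structure, declared with absolute names):

* `Combinatorics.Subspace.comp` — a subspace `W` of the parameter cube `η → α` of `V` gives the
  subspace `V.comp W` of `ι → α` ("identifying `V` with `[k]^m`", DKT §2), `(V.comp W) x = V (W x)`;
* `Combinatorics.Subspace.pat` — the action of `V` on variable words `η → Option α`, and
  `Combinatorics.Subspace.line` — the line `V.line l` of `ι → α` generated by a line `l` of the
  parameter cube (`Lines(V)` of DKT §2 is `{V.line l}`), `V.line l a = V (l a)`;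
* `Combinatorics.Subspace.injective` — `x ↦ V x` is injective;
* `Combinatorics.Subspace.mapLetters` — change of alphabet along `f : α → α'` (for `f = some`:
  an `m`-variable word over `[k]` read over `[k+1]`; its points with variables in `[k]` form
  `V ↾ k`, DKT §2);
* `Combinatorics.Subspace.extend` / `extendWord` — padding along an embedding `ι ↪ ι'` with a
  constant letter;
* `exists_mono_subspace_of_card_le` — the multidimensional Hales–Jewett theorem for ALL index
  types of cardinality at least some `N` (Mathlib gives one large dimension; monotonicity in the
  dimension by padding; `α κ η` universe-polymorphic, the index types `ι` in `Type`), and the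
  line version `exists_mono_line_of_card_le`.

## References
* A. W. Hales, R. I. Jewett, *Regularity and positional games*, Trans. AMS 106 (1963), 222–229.
  [cite: HalesJewett1963]
* P. Dodos, V. Kanellopoulos, K. Tyros, IMRN 2014 (12), 3340–3352, §2.
  [cite: DodosKanellopoulosTyros2014]
-/

namespace Combinatorics

namespace Subspace

variable {η η' α α' ι ι' κ : Type*}

/-- **Composition of subspaces** (DKT §2: a subspace `W` of `[k]^m ≅ V` is a subspace of
`[k]^n`): the coordinate `i` of `V.comp W` is the constant of `V` at `i` if there is one, and
otherwise the entry of `W` at the variable of `V` occurring at `i`. Deliberate dot-notation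
extension of Mathlib's `Combinatorics.Subspace`. [cite: DodosKanellopoulosTyros2014, Section 2] -/
def comp (V : Subspace η α ι) (W : Subspace η' α η) : Subspace η' α ι where
  idxFun i := (V.idxFun i).elim Sum.inl W.idxFun
  proper e' := by
    obtain ⟨e, he⟩ := W.proper e'
    obtain ⟨i, hi⟩ := V.proper e
    exact ⟨i, by simp [hi, he]⟩

/-- `(V.comp W) x = V (W x)`. [folklore] -/
@[simp] theorem comp_apply (V : Subspace η α ι) (W : Subspace η' α η) (x : η' → α) :
    (V.comp W) x = V (W x) := by
  funext i
  simp only [coe_apply, comp]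
  cases V.idxFun i <;> simp [coe_apply]

/-- **Action of a subspace on variable words**: substituting the variable word `w` over `α`
(letters `some a`, the variable letter `none`) into the `m`-variable word `V` gives a word over
`Option α`; when `w` uses the variable this is the variable word of a line of `V` (see
`Subspace.line`). Deliberate dot-notation extension of Mathlib's `Combinatorics.Subspace`.
[cite: DodosKanellopoulosTyros2014, Section 2] -/
def pat (V : Subspace η α ι) (w : η → Option α) : ι → Option α :=
  fun i => (V.idxFun i).elim some w

/-- Coordinates of `V.pat w`: a constant coordinate of `V` stays that constant. [folklore] -/
theorem pat_apply_inl {V : Subspace η α ι} {w : η → Option α} {i : ι} {a : α}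
    (h : V.idxFun i = Sum.inl a) : V.pat w i = some a := by
  simp [pat, h]

/-- Coordinates of `V.pat w`: a variable coordinate of `V` receives the entry of `w`. [folklore] -/
theorem pat_apply_inr {V : Subspace η α ι} {w : η → Option α} {i : ι} {e : η}
    (h : V.idxFun i = Sum.inr e) : V.pat w i = w e := by
  simp [pat, h]

/-- `V.pat w i = none` exactly when `i` carries a variable `e` of `V` with `w e = none`.
[folklore] -/
theorem pat_eq_none_iff (V : Subspace η α ι) (w : η → Option α) (i : ι) :
    V.pat w i = none ↔ ∃ e, V.idxFun i = Sum.inr e ∧ w e = none := by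
  unfold pat
  cases h : V.idxFun i with
  | inl a => simp
  | inr e => simp

/-- On honest words (no variable) the action on variable words is the action on words:
`V.pat (some ∘ x) = some ∘ V x`. [folklore] -/
@[simp] theorem pat_some (V : Subspace η α ι) (x : η → α) :
    V.pat (some ∘ x) = some ∘ V x := by
  funext i
  simp only [pat, Function.comp_apply, coe_apply]
  cases V.idxFun i <;> simp

/-- The action on variable words is compatible with composition. [folklore] -/
@[simp] theorem comp_pat (V : Subspace η α ι) (W : Subspace η' α η) (w : η' → Option α) :
    (V.comp W).pat w = V.pat (W.pat w) := by
  funext i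
  simp only [pat, comp]
  cases V.idxFun i <;> rfl

/-- **The line of `V` generated by a line of its parameter cube** (`Lines(V)` of DKT §2 is the
set of these): its variable word is `V.pat l.idxFun`. Deliberate dot-notation extension of
Mathlib's `Combinatorics.Subspace`. [cite: DodosKanellopoulosTyros2014, Section 2] -/
def line (V : Subspace η α ι) (l : Line α η) : Line α ι where
  idxFun := V.pat l.idxFun
  proper := by
    obtain ⟨e, he⟩ := l.proper
    obtain ⟨i, hi⟩ := V.proper e
    exact ⟨i, (V.pat_eq_none_iff _ i).2 ⟨e, hi, he⟩⟩

/-- The variable word of `V.line l`. [folklore] -/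
@[simp] theorem line_idxFun (V : Subspace η α ι) (l : Line α η) :
    (V.line l).idxFun = V.pat l.idxFun := rfl

/-- The points of `V.line l` are the images of the points of `l`: `V.line l a = V (l a)`.
[folklore] -/
@[simp] theorem line_apply (V : Subspace η α ι) (l : Line α η) (a : α) :
    V.line l a = V (l a) := by
  funext i
  simp only [Line.coe_apply, line_idxFun, pat, coe_apply]
  cases V.idxFun i <;> simp

/-- Lines are transported along compositions: `(V.comp W).line l = V.line (W.line l)`.
[folklore] -/
@[simp] theorem comp_line (V : Subspace η α ι) (W : Subspace η' α η) (l : Line α η') :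
    (V.comp W).line l = V.line (W.line l) :=
  Line.ext (comp_pat V W l.idxFun)

/-- A subspace is an injective parametrisation of its points (every variable occurs).
[folklore] -/
theorem injective (V : Subspace η α ι) : Function.Injective (⇑V : (η → α) → ι → α) := by
  intro x y hxy
  funext e
  obtain ⟨i, hi⟩ := V.proper e
  have := congr_fun hxy i
  rwa [V.apply_inr hi, V.apply_inr hi] at this

/-- The action on variable words is injective as well. [folklore] -/
theorem pat_injective (V : Subspace η α ι) : Function.Injective V.pat := by
  intro w w' h
  funext e
  obtain ⟨i, hi⟩ := V.proper e
  have := congr_fun h i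
  rwa [V.pat_apply_inr hi, V.pat_apply_inr hi] at this

/-- **Change of alphabet**: push the constants of `V` along `f : α → α'` (for `f = some` this
views an `m`-variable word over `[k]` as one over `[k+1]`, whose points with variables in `[k]`
form `V ↾ k`, DKT §2). Deliberate dot-notation extension.
[cite: DodosKanellopoulosTyros2014, Section 2] -/
def mapLetters (f : α → α') (V : Subspace η α ι) : Subspace η α' ι where
  idxFun i := (V.idxFun i).map f id
  proper e := by
    obtain ⟨i, hi⟩ := V.proper e
    exact ⟨i, by simp [hi]⟩

/-- Points of `V.mapLetters f` at `f ∘ x` are `f ∘ V x`. [folklore] -/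
@[simp] theorem mapLetters_apply (f : α → α') (V : Subspace η α ι) (x : η → α) :
    V.mapLetters f (f ∘ x) = f ∘ V x := by
  funext i
  simp only [coe_apply, mapLetters, Function.comp_apply]
  cases V.idxFun i <;> simp

/-- Variables of `V.mapLetters f` are those of `V`. [folklore] -/
theorem mapLetters_idxFun_eq_inr_iff (f : α → α') (V : Subspace η α ι) (i : ι) (e : η) :
    (V.mapLetters f).idxFun i = Sum.inr e ↔ V.idxFun i = Sum.inr e := by
  simp only [mapLetters]
  cases V.idxFun i <;> simp

/-- `mapLetters` commutes with composition. [folklore] -/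
theorem mapLetters_comp (f : α → α') (V : Subspace η α ι) (W : Subspace η' α η) :
    (V.comp W).mapLetters f = (V.mapLetters f).comp (W.mapLetters f) := by
  ext i : 2
  simp only [mapLetters, comp]
  cases V.idxFun i <;> simp

/-- **Padding**: a subspace of `ι → α` becomes a subspace of `ι' → α` along an embedding
`f : ι ↪ ι'`, constant `a₀` off the range of `f`. Deliberate dot-notation extension. [folklore] -/
noncomputable def extend (V : Subspace η α ι) (f : ι ↪ ι') (a₀ : α) : Subspace η α ι' where
  idxFun := Function.extend f V.idxFun fun _ => Sum.inl a₀
  proper e := by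
    obtain ⟨i, hi⟩ := V.proper e
    exact ⟨f i, by rw [f.injective.extend_apply, hi]⟩

end Subspace

end Combinatorics

namespace Literature.Combinatorics.HalesJewett

open _root_.Combinatorics

variable {η α ι ι' κ : Type*}

/-- Padding of words along an embedding `f : ι ↪ ι'` with the constant letter `a₀`. [folklore] -/
noncomputable def extendWord (f : ι ↪ ι') (a₀ : α) (x : ι → α) : ι' → α :=
  Function.extend f x fun _ => a₀

/-- `extendWord f a₀ x (f i) = x i`. [folklore] -/
@[simp] theorem extendWord_apply (f : ι ↪ ι') (a₀ : α) (x : ι → α) (i : ι) :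
    extendWord f a₀ x (f i) = x i := by
  simp [extendWord, f.injective.extend_apply]

/-- Off the range of `f`, `extendWord f a₀ x` is the constant `a₀`. [folklore] -/
theorem extendWord_apply_of_not_exists (f : ι ↪ ι') (a₀ : α) (x : ι → α) (i' : ι')
    (h : ¬∃ i, f i = i') : extendWord f a₀ x i' = a₀ := by
  simp [extendWord, Function.extend_apply' _ _ _ h]

/-- Restricting a padded word back along `f` recovers it. [folklore] -/
@[simp] theorem extendWord_comp (f : ι ↪ ι') (a₀ : α) (x : ι → α) :
    extendWord f a₀ x ∘ f = x := by
  funext i; simp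

/-- The points of the padded subspace are the padded points. [folklore] -/
@[simp] theorem extend_apply (V : Subspace η α ι) (f : ι ↪ ι') (a₀ : α) (x : η → α) :
    V.extend f a₀ x = extendWord f a₀ (V x) := by
  funext i'
  by_cases h : ∃ i, f i = i'
  · obtain ⟨i, rfl⟩ := h
    simp [Subspace.extend, Subspace.coe_apply, f.injective.extend_apply, extendWord]
  · simp [Subspace.extend, Subspace.coe_apply, Function.extend_apply' _ _ _ h,
      extendWord_apply_of_not_exists f a₀ _ i' h]

/-- **The multidimensional Hales–Jewett theorem in every large dimension**: for finite `α`
(nonempty), `κ`, `η` there is `N` such that every `κ`-colouring of `ι → α` with `N ≤ |ι|` has a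
monochromatic `η`-dimensional subspace. (Mathlib's `Subspace.exists_mono_in_high_dimension_fin`
gives one good dimension `n`; a colouring of a larger cube restricts, along any embedding
`Fin n ↪ ι` and padding with a constant letter, to one of `Fin n → α`.)
[cite: HalesJewett1963, main theorem (its multidimensional corollary, cf. DKT 2014 §2)] -/
theorem exists_mono_subspace_of_card_le (α : Type*) (κ : Type*) (η : Type*) [Finite α]
    [Nonempty α] [Finite κ] [Finite η] : ∃ N : ℕ, ∀ (ι : Type) [Fintype ι], N ≤ Fintype.card ι →
      ∀ C : (ι → α) → κ, ∃ S : Subspace η α ι, S.IsMono C := by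
  obtain ⟨n, hn⟩ := Subspace.exists_mono_in_high_dimension_fin α κ η
  refine ⟨n, fun ι _ hι C => ?_⟩
  obtain ⟨f⟩ : Nonempty (Fin n ↪ ι) :=
    Function.Embedding.nonempty_of_card_le (by simpa using hι)
  obtain ⟨a₀⟩ := ‹Nonempty α›
  obtain ⟨S, c, hc⟩ := hn fun x => C (extendWord f a₀ x)
  exact ⟨S.extend f a₀, c, fun x => by rw [extend_apply]; exact hc x⟩

/-- **The Hales–Jewett theorem in every large dimension** (lines).
[cite: HalesJewett1963, main theorem] -/
theorem exists_mono_line_of_card_le (α : Type*) (κ : Type*) [Finite α] [Nonempty α]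
    [Finite κ] : ∃ N : ℕ, ∀ (ι : Type) [Fintype ι], N ≤ Fintype.card ι →
      ∀ C : (ι → α) → κ, ∃ l : Line α ι, l.IsMono C := by
  obtain ⟨N, hN⟩ := exists_mono_subspace_of_card_le α κ Unit
  refine ⟨N, fun ι _ hι C => ?_⟩
  obtain ⟨S, c, hc⟩ := hN ι hι C
  refine ⟨⟨fun i => (S.idxFun i).elim some fun _ => none, ?_⟩, c, fun a => ?_⟩
  · obtain ⟨i, hi⟩ := S.proper ()
    exact ⟨i, by simp [hi]⟩
  · convert hc (fun _ => a) using 2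
    funext i
    simp only [Line.coe_apply, Subspace.coe_apply]
    cases S.idxFun i <;> simp

end Literature.Combinatorics.HalesJewett
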